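import Summits.BirchSwinnertonDyer.Rank1Residual.X11b.LevelShiftMaps
import Summits.BirchSwinnertonDyer.Rank1Residual.X11b.WeilTransport
import Summits.BirchSwinnertonDyer.Rank1Residual.X11b.PropagatedUnramified
import Summits.BirchSwinnertonDyer.Rank1Residual.X11b.PropagatedLocalConditions
import Summits.BirchSwinnertonDyer.Rank1Residual.X11b.LocSurjFromLevels
import Summits.BirchSwinnertonDyer.Rank1Residual.X11b.PoitouTateSelmerCounting
import Literature.NumberTheory.GaloisCohomology.PoitouTateSelmerStructures
import Literature.NumberTheory.EllipticCurves.GoodReductionUnramifiedProofs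
import HarnessLib

/-!
# X11b, route R1 — the LOWER Selmer structure `𝓕 ≤ 𝓛^{(N),Σ}` of the (P9) argument, the test
# family, and the Weil transport of a dual Selmer class into Castella's relaxed conjugate group

HONEST FRAMING (cell `b2b-bsdres`, run/shared/lean/b2b/bsd-rank1-residual/, verbatim in every
file): the goal of the cell is to DELETE the COMBINATION-SHAPED residual classes of the
Birch–Swinnerton-Dyer formula for ALL analytic-rank `≤ 1` elliptic curves over `ℚ` — "full BSD
formula for every rank `≤ 1` curve in class `C`" assembled STRICTLY from published theorems — so
that the rank-`≤ 1` remainder becomes exactly the CONSTRUCTION-SHAPED classes, which are TYPED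
(missing-input `Prop`s), NOT attempted. This is not "finishing BSD". Sub-cell
`b2b-bsdres-multr1-p1` (X11b, route R1 = Castella 2018 Thm. A re-proved along the author's
erratum); a RESEARCH ROUTE; no claim beyond the stated class; X11b stays CONSTRUCTION-SHAPED;
nothing here changes a label; no named fact is minted (two definitions with bodies — a Selmer
structure and a family of local classes — and theorems; no `sorry`).

## What is here (JSW17, proof of Prop. 3.3.2; Howard 2004 Thm. 2.1.11 (i))

To lift a family of local classes `τ_w ∈ H¹(K_w, E[p^∞])[p^{K₀}]` (`w ∈ Σ`) to Castella's
`Σ`-imprimitive Selmer group (atom (P9) = `LevelLiftingAt`, `LocSurjFromLevels`) one applies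
Poitou–Tate duality for Selmer structures (tree fact `poitouTate_selmerStructure_duality`,
`SelmerComplement` (i)) at the finite level `M = E[p^N]`, `N = K₀ + e`, to the pair `𝓕 ≤ 𝓖` with
`𝓖 = 𝓛^{(N),Σ} = acLevelStructure W p N 𝔭 Σ` and

* `AcSelmer.lowerStructure W p N 𝔭 Σ T = 𝓕`: equal to `𝓖` except at the finite places `v ∈ T`
  away from `p` (`T` the finite exceptional set of the Poitou–Tate statement: `∞`, `v ∣ p`, `Σ`,
  bad places), where it is `0` — so that a lift `x` with `loc_v x ≡ t_v (mod 𝓕_v)` has EXACTLY the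
  prescribed components on `Σ`, and so that the dual condition `𝓕^*_v = ⊤` there costs nothing but
  the finiteness of Castella's `T`-RELAXED conjugate group (no co-isotropy at bad places needed);
  `lowerStructure_le`, `lowerStructure_isUnramifiedOutside`;
* `AcSelmer.liftFamily`: the test family `t_v = H¹(ι|_v) s_v` (`v ∈ Σ`), `0` elsewhere;
* `isUnramifiedAt_torsionGaloisModule`: `E[n]` is unramified at good `v ∤ n` (Silverman VII.4.1);
* `exists_pow_nsmul_eq_zero_of_finite`: a finite subgroup of `H¹(K, E[p^∞])` is killed by some `p^e`;
* **`AcSelmer.map_weilTransport_mem_selmerGroup_acStructure`**: for `y ∈ H¹_{𝓕^*}(K, E[p^N]^D)`,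
  the Weil transport `yW = H¹(w⁻¹) y ∈ H¹(K, E[p^N])` pushes to a class of Castella's RELAXED
  conjugate Selmer group `H¹_{𝓛^{ac,R}_{𝔮}}(K, E[p^∞])` (`𝔮 = 𝔭̄`, `R = {v ∈ T : v ∤ p}`): at `𝔮`,
  `𝓕^*_𝔮 = (⊤)^* = 0`; at good `v ∉ T`, `𝓕^*_v = H¹_ur^* = H¹_ur` (Milne I 2.6, `UnramifiedOrthogonal`)
  and `H¹_ur(K_v, E[p^N]) = ker (H¹(K_v, E[p^N]) → H¹(K_v, E[p^∞]))` (`PropagatedUnramified`);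
  complex places carry nothing.  This is JSW's "`H¹_{(F_ac^S)_v̄}(K, T) → H¹_{(F_ac^S)_v̄}(K, W)`".

References: [JetchevSkinnerWan2017] Prop. 3.3.2 (arXiv:1512.06894 p. 11); [Howard2004HeegnerKolyvagin]
Def. 2.1.6, 2.1.10, Thm. 2.1.11; [MilneADT2006] I Thm. 2.6, Thm. 4.10; [Castella2018] Def. 2.2.
-/

noncomputable section

open scoped Classical

open CategoryTheory Field NumberField IsDedekindDomain
open Literature.NumberTheory.EllipticCurves Literature.NumberTheory.EllipticCurves.GreenbergSelmer
open Literature.NumberTheory.GaloisRepresentations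
open Literature.NumberTheory.GaloisRepresentations.DiscreteGaloisModule (SelmerStructure TateDual tateDual
  localTatePairingZMod unramifiedSubgroup)
open Literature.NumberTheory.GaloisCohomology
open scoped ContRepresentation

namespace Summit.BirchSwinnertonDyer.Rank1Residual.X11b.AcSelmer

open Summit.BirchSwinnertonDyer.Rank1Residual.X11b.LocBridge
open Summit.BirchSwinnertonDyer.Rank1Residual.X11b.Levels

variable {K : Type} [Field K] [NumberField K] (W : WeierstrassCurve K) (p : ℕ)

/-! ## §1. `E[n]` is unramified at a good place `v ∤ n` -/

/-- **`E[n]` is unramified at every good place `v ∤ n`** in the sense of the tree's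
`GaloisRep.IsUnramifiedAt` (all inertia groups above `v` act trivially): Silverman VII.4.1(a), tree
`smul_geomTorsion_eq_of_mem_inertia`. This is the hypothesis "`S ⊇ Ram(M)`" of the Poitou–Tate fact.
[cite: SilvermanAEC2009, Prop. VII.4.1(a)] -/
theorem isUnramifiedAt_torsionGaloisModule [W.IsElliptic] {v : HeightOneSpectrum (𝓞 K)}
    (hv : W.HasGoodReductionAt v) {n : ℤ} (hn : (n : 𝓞 K) ∉ v.asIdeal) :
    GaloisRep.IsUnramifiedAt v (W.torsionGaloisModule n) := fun 𝔓 h𝔓 τ hτ ↦ by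
  refine LinearMap.ext fun P ↦ ?_
  exact W.smul_geomTorsion_eq_of_mem_inertia hv hn h𝔓 hτ P

omit [NumberField K] in
/-- `p^k ∉ v` for a finite place `v ∤ p` (as an element of `𝓞 K`, integer form). [folklore] -/
theorem intCast_pow_not_mem {v : HeightOneSpectrum (𝓞 K)} (hpv : ((p : ℕ) : 𝓞 K) ∉ v.asIdeal)
    (k : ℕ) : ((((p ^ k : ℕ) : ℤ) : 𝓞 K)) ∉ v.asIdeal := by
  rw [Int.cast_natCast, Nat.cast_pow]
  exact fun h ↦ hpv (v.isPrime.mem_of_pow_mem k h)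

omit [NumberField K] in
/-- `p^k ∉ v` for a finite place `v ∤ p` (natural-number form). [folklore] -/
theorem natCast_pow_not_mem {v : HeightOneSpectrum (𝓞 K)} (hpv : ((p : ℕ) : 𝓞 K) ∉ v.asIdeal)
    (k : ℕ) : ((p ^ k : ℕ) : 𝓞 K) ∉ v.asIdeal := by
  rw [Nat.cast_pow]
  exact fun h ↦ hpv (v.isPrime.mem_of_pow_mem k h)

/-! ## §2. The lower structure `𝓕` -/

variable (N : ℕ) (𝔭 : HeightOneSpectrum (𝓞 K)) (S : Set (HeightOneSpectrum (𝓞 K)))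
  (T : Finset (Place K))

/-- **The lower structure `𝓕` on `E[p^N]`**: Castella's propagated structure `𝓛^{(N),Σ}` made `0`
(strict) at the finite places of `T` away from `p`; equal to it elsewhere. A definition; nothing
asserted. [cite: Howard2004HeegnerKolyvagin, Thm. 2.1.11 (arXiv:1202.6340 p. 6)]
[cite: JetchevSkinnerWan2017, Prop. 3.3.2 (arXiv:1512.06894 p. 11)] -/
def lowerStructure : SelmerStructure (W.torsionGaloisModule ((p ^ N : ℕ) : ℤ)) := fun v ↦
  match v with
  | Sum.inl w => acLevelStructure W p N 𝔭 S (Sum.inl w)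
  | Sum.inr v =>
    if (Sum.inr v : Place K) ∈ T ∧ ((p : ℕ) : 𝓞 K) ∉ v.asIdeal then ⊥
    else acLevelStructure W p N 𝔭 S (Sum.inr v)

/-- `𝓕` at an infinite place. [folklore] -/
@[simp]
theorem lowerStructure_inl (w : InfinitePlace K) :
    lowerStructure W p N 𝔭 S T (Sum.inl w) = acLevelStructure W p N 𝔭 S (Sum.inl w) :=
  rfl

/-- `𝓕 = 0` at a finite place of `T` away from `p`. [folklore] -/
theorem lowerStructure_inr_of_mem {v : HeightOneSpectrum (𝓞 K)} (hvT : (Sum.inr v : Place K) ∈ T)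
    (hpv : ((p : ℕ) : 𝓞 K) ∉ v.asIdeal) : lowerStructure W p N 𝔭 S T (Sum.inr v) = ⊥ := by
  change (if (Sum.inr v : Place K) ∈ T ∧ ((p : ℕ) : 𝓞 K) ∉ v.asIdeal then ⊥ else _) = _
  rw [if_pos ⟨hvT, hpv⟩]

/-- `𝓕 = 𝓛^{(N),Σ}` at the other finite places. [folklore] -/
theorem lowerStructure_inr_of_not {v : HeightOneSpectrum (𝓞 K)}
    (h : ¬ ((Sum.inr v : Place K) ∈ T ∧ ((p : ℕ) : 𝓞 K) ∉ v.asIdeal)) :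
    lowerStructure W p N 𝔭 S T (Sum.inr v) = acLevelStructure W p N 𝔭 S (Sum.inr v) := by
  change (if (Sum.inr v : Place K) ∈ T ∧ ((p : ℕ) : 𝓞 K) ∉ v.asIdeal then ⊥ else _) = _
  rw [if_neg h]

/-- **`𝓕 ≤ 𝓛^{(N),Σ}`.** [cite: Howard2004HeegnerKolyvagin, Thm. 2.1.11 (arXiv:1202.6340 p. 6)] -/
theorem lowerStructure_le : lowerStructure W p N 𝔭 S T ≤ acLevelStructure W p N 𝔭 S := by
  intro v
  cases v with
  | inl w => exact le_rfl
  | inr v =>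
    by_cases h : (Sum.inr v : Place K) ∈ T ∧ ((p : ℕ) : 𝓞 K) ∉ v.asIdeal
    · rw [lowerStructure_inr_of_mem W p N 𝔭 S T h.1 h.2]; exact bot_le
    · rw [lowerStructure_inr_of_not W p N 𝔭 S T h]

/-- **`𝓕` is unramified outside `T`** (for `T ⊇ ∞ ∪ {v ∣ p} ∪ Σ ∪ {bad}`): off `T` it IS
`𝓛^{(N),Σ}`, unramified there (`acLevelStructure_isUnramifiedOutside`).
[cite: Howard2004HeegnerKolyvagin, Def. 2.1.10 (arXiv:1202.6340 p. 6)] -/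
theorem lowerStructure_isUnramifiedOutside [W.IsElliptic] [Fact p.Prime]
    (hinf : ∀ w : InfinitePlace K, (Sum.inl w : Place K) ∈ T)
    (hp : ∀ v : HeightOneSpectrum (𝓞 K), ((p : ℕ) : 𝓞 K) ∈ v.asIdeal → (Sum.inr v : Place K) ∈ T)
    (hSig : ∀ v ∈ S, (Sum.inr v : Place K) ∈ T)
    (hbad : ∀ v : HeightOneSpectrum (𝓞 K), ¬ W.HasGoodReductionAt v → (Sum.inr v : Place K) ∈ T) :
    SelmerStructure.IsUnramifiedOutside (lowerStructure W p N 𝔭 S T) T := by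
  refine ⟨hinf, fun v hv ↦ ?_⟩
  rw [lowerStructure_inr_of_not W p N 𝔭 S T (fun h ↦ hv h.1)]
  exact (acLevelStructure_isUnramifiedOutside W p N 𝔭 S T hinf hp hSig hbad).2 v hv

/-! ## §3. The test family -/

variable {S} (K₀ e : ℕ)

/-- **The test family `t`** of local classes of `E[p^{K₀+e}]`: at `v ∈ Σ` the push-forward
`H¹(ι|_v) s_v` of a level-`p^{K₀}` local class `s_v`, and `0` at every other place. A definition.
[cite: JetchevSkinnerWan2017, Prop. 3.3.2 (arXiv:1512.06894 p. 11)] -/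
def liftFamily
    (s : ∀ v : S, galoisCohomology (GaloisRep.restrictField
      (Place.Completion (Sum.inr (v : HeightOneSpectrum (𝓞 K)) : Place K))
      (W.torsionGaloisModule ((p ^ K₀ : ℕ) : ℤ))) 1) :
    Π v : Place K, galoisCohomology ((W.torsionGaloisModule ((p ^ (K₀ + e) : ℕ) : ℤ)).toLocal v) 1
  | Sum.inl _ => 0
  | Sum.inr v =>
    if hv : v ∈ S then
      galoisCohomology.map ((levelIncl W p K₀ e).restrictField (Place.Completion (Sum.inr v : Place K)))
        1 (s ⟨v, hv⟩)
    else 0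

variable (s : ∀ v : S, galoisCohomology (GaloisRep.restrictField
    (Place.Completion (Sum.inr (v : HeightOneSpectrum (𝓞 K)) : Place K))
    (W.torsionGaloisModule ((p ^ K₀ : ℕ) : ℤ))) 1)

/-- `t` at an infinite place is `0`. [folklore] -/
@[simp]
theorem liftFamily_inl (w : InfinitePlace K) : liftFamily W p K₀ e s (Sum.inl w) = 0 :=
  rfl

/-- `t` at `v ∈ Σ`. [folklore] -/
theorem liftFamily_inr_of_mem {v : HeightOneSpectrum (𝓞 K)} (hv : v ∈ S) :
    liftFamily W p K₀ e s (Sum.inr v) =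
      galoisCohomology.map ((levelIncl W p K₀ e).restrictField (Place.Completion (Sum.inr v : Place K)))
        1 (s ⟨v, hv⟩) := by
  change (if hv : v ∈ S then _ else _) = _
  rw [dif_pos hv]

/-- `t` at a finite `v ∉ Σ` is `0`. [folklore] -/
theorem liftFamily_inr_of_not_mem {v : HeightOneSpectrum (𝓞 K)} (hv : v ∉ S) :
    liftFamily W p K₀ e s (Sum.inr v) = 0 := by
  change (if hv : v ∈ S then _ else _) = _
  rw [dif_neg hv]

/-! ## §4. A finite subgroup of `H¹(K, E[p^∞])` has a `p`-power exponent -/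

variable {W p} in
omit [NumberField K] in
/-- **A finite subgroup of `H¹(K, E[p^∞])` is killed by a power of `p`** (each class is, by
compactness of `Γ_K`: `Levels.exists_pow_nsmul_eq_zero_of_primary`; take the sum of the exponents).
[folklore] -/
theorem exists_pow_nsmul_eq_zero_of_finite (G : AddSubgroup (galoisCohomology (primaryGaloisModule W p) 1))
    [Finite G] : ∃ e : ℕ, 1 ≤ e ∧ ∀ x ∈ G, p ^ e • x = 0 := by
  haveI : Fintype G := Fintype.ofFinite G
  have hB : ∀ Q : W.geomPrimaryTorsion p, ∃ k : ℕ, p ^ k • Q = 0 := fun Q ↦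
    (AddCommGroup.mem_primaryComponent.mp Q.2).imp fun k hk ↦
      Subtype.ext (by rw [AddSubmonoidClass.coe_nsmul, hk, ZeroMemClass.coe_zero])
  choose k hk using fun g : G ↦ exists_pow_nsmul_eq_zero_of_primary (primaryGaloisModule W p) hB (g : _)
  refine ⟨Finset.univ.sum k + 1, Nat.le_add_left 1 _, fun x hx ↦ ?_⟩
  have hle : k ⟨x, hx⟩ ≤ Finset.univ.sum k + 1 :=
    (Finset.single_le_sum (fun _ _ ↦ Nat.zero_le _) (Finset.mem_univ _)).trans (Nat.le_succ _)
  rw [← pow_mul_pow_sub p hle, mul_comm, mul_smul, show p ^ k ⟨x, hx⟩ • x = 0 from hk ⟨x, hx⟩,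
    smul_zero]

/-! ## §5. Weil transport of a dual Selmer class into Castella's relaxed conjugate group -/

section Transport

variable {N} [W.IsElliptic] [Fact p.Prime]

attribute [local instance] Levels.neZero_pow finite_geomTorsion_pow

variable (ε : W.geomTorsion ((p ^ N : ℕ) : ℤ) → W.geomTorsion ((p ^ N : ℕ) : ℤ) → AlgebraicClosure K)
  (hμ : ∀ Q R, ε Q R ^ (p ^ N) = 1)
  (hadd₁ : ∀ Q₁ Q₂ R, ε (Q₁ + Q₂) R = ε Q₁ R * ε Q₂ R)
  (hadd₂ : ∀ Q R₁ R₂, ε Q (R₁ + R₂) = ε Q R₁ * ε Q R₂)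
  (hgal : ∀ (σ : absoluteGaloisGroup K) (Q R : W.geomTorsion ((p ^ N : ℕ) : ℤ)),
    σ • ε Q R = ε (σ • Q) (σ • R))
  (hnondeg : ∀ R, (∀ Q, ε Q R = 1) → R = 0)

/-- **The Weil transport of a dual Selmer class lies in Castella's RELAXED conjugate group.**  Let
`𝓕 = lowerStructure W p N 𝔭 Σ T` (`T ⊇ ∞ ∪ {v∣p} ∪ Σ ∪ {bad}`), `inv` a family of local invariant
maps with local Tate duality (`IsPerfect`) and Milne I 2.6 (`UnramifiedOrthogonal`) at level `p^N`,
all infinite places complex, `𝔭, 𝔮 ∣ p`, `𝔮 ≠ 𝔭`.  For `y ∈ H¹_{𝓕^*}(K, E[p^N]^D)` the class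
`H¹(ι_N)(H¹(w⁻¹) y) ∈ H¹(K, E[p^∞])` lies in `H¹_{𝓛^{ac,R}_𝔮}(K, E[p^∞])`, Castella's structure for the
CONJUGATE prime `𝔮` relaxed on `R = {v ∈ T : v ∤ p}`: strict at `𝔮` because `𝓕^*_𝔮 = ⊤^* = 0`;
trivial at good `v ∉ T` because `𝓕^*_v = H¹_ur(E[p^N]^D)`, `w⁻¹` preserves `H¹_ur`, and
`H¹_ur(K_v, E[p^N])` dies in `H¹(K_v, E[p^∞])`; nothing to check at complex places, at `v ∣ p`,
`v ≠ 𝔮`, and on `R`.  (JSW17 proof of Prop. 3.3.2: the map `H¹_{(F_ac^S)_v̄}(K, M[p^N]^*) →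
H¹_{(F_ac^S)_v̄}(K, W)`.) [cite: JetchevSkinnerWan2017, Prop. 3.3.2 (arXiv:1512.06894 p. 11)]
[cite: MilneADT2006, Ch. I, Thm. 2.6] -/
theorem map_weilTransport_mem_selmerGroup_acStructure (hK : ∀ w : InfinitePlace K, w.IsComplex)
    {𝔮 : HeightOneSpectrum (𝓞 K)} (h𝔮 : ((p : ℕ) : 𝓞 K) ∈ 𝔮.asIdeal) (hne : 𝔮 ≠ 𝔭)
    (hSig : ∀ v ∈ S, (Sum.inr v : Place K) ∈ T)
    (hbad : ∀ v : HeightOneSpectrum (𝓞 K), ¬ W.HasGoodReductionAt v → (Sum.inr v : Place K) ∈ T)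
    {inv : LocalInvariants K (p ^ N)} (hperf : inv.IsPerfect) (hur : inv.UnramifiedOrthogonal)
    {y : galoisCohomology ((W.torsionGaloisModule ((p ^ N : ℕ) : ℤ)).tateDual (p ^ N)) 1}
    (hy : y ∈ (inv.dualSelmerStructure (W.torsionGaloisModule ((p ^ N : ℕ) : ℤ))
        (lowerStructure W p N 𝔭 S T)).selmerGroup) :
    galoisCohomology.map (primaryInclusion W p N) 1
        (galoisCohomology.map (weilDualInv W (p ^ N) ε hμ hadd₁ hadd₂ hgal hnondeg) 1 y) ∈
      (acStructure (primaryGaloisModule W p) p 𝔮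
        {v | (Sum.inr v : Place K) ∈ T ∧ ((p : ℕ) : 𝓞 K) ∉ v.asIdeal}).selmerGroup := by
  set yW := galoisCohomology.map (weilDualInv W (p ^ N) ε hμ hadd₁ hadd₂ hgal hnondeg) 1 y with hyWdef
  have hyW : galoisCohomology.map (weilDualIntertwining W (p ^ N) ε hμ hadd₁ hadd₂ hgal) 1 yW = y :=
    map_weilDual_map_weilDualInv W (p ^ N) ε hμ hadd₁ hadd₂ hgal hnondeg y
  have hMn : ∀ m : W.geomTorsion ((p ^ N : ℕ) : ℤ), (p ^ N) • m = 0 := fun m ↦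
    AddSubgroup.torsionBy.nsmul m
  have hy' := hy
  rw [SelmerStructure.mem_selmerGroup_iff] at hy'
  rw [SelmerStructure.mem_selmerGroup_iff]
  intro v
  cases v with
  | inl w =>
    rw [acStructure_inl, AddSubgroup.mem_bot]
    exact localization_inl_eq_zero_of_isComplex _ (hK w) _
  | inr v =>
    rw [acStructure_inr]
    split_ifs with h
    · rw [AddSubgroup.mem_bot, localization_map_one]
      rcases h with rfl | ⟨hpv, hvR⟩
      · -- at `𝔮`: `𝓕_𝔮 = ⊤`, so `𝓕^*_𝔮 = 0`, so `loc_𝔮 y = 0`, so `loc_𝔮 yW = 0`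
        have h𝓕 : lowerStructure W p N 𝔭 S T (Sum.inr v) = ⊤ := by
          rw [lowerStructure_inr_of_not W p N 𝔭 S T (fun h ↦ h.2 h𝔮)]
          exact acLevelStructure_eq_top_of_mem_of_ne W p N 𝔭 S h𝔮 hne
        have hyv := hy' (Sum.inr v)
        rw [LocalInvariants.dualSelmerStructure_apply, h𝓕,
          PoitouTateCounting.dualLocalCondition_top hperf (W.torsionGaloisModule ((p ^ N : ℕ) : ℤ)) hMn v, AddSubgroup.mem_bot, ← hyW,
          localization_map_one] at hyv
        have hyWv : galoisCohomology.localization (W.torsionGaloisModule ((p ^ N : ℕ) : ℤ)) (Sum.inr v) 1 yW = 0 :=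
          map_weilDual_restrictField_injective W (p ^ N) ε hμ hadd₁ hadd₂ hgal hnondeg _
            (hyv.trans (map_zero _).symm)
        rw [hyWv]
        exact map_zero _
      · -- at a good `v ∉ T` away from `p`: `𝓕^*_v = H¹_ur`, transported to `H¹_ur(K_v, E[p^N]) = ker`
        have hvT : (Sum.inr v : Place K) ∉ T := fun hvT ↦ hvR ⟨hvT, hpv⟩
        have hvS : v ∉ S := fun hvS ↦ hvT (hSig v hvS)
        have hgood : W.HasGoodReductionAt v := by
          by_contra hbad'
          exact hvT (hbad v hbad')
        have h𝓕 : lowerStructure W p N 𝔭 S T (Sum.inr v) =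
            unramifiedSubgroup (GaloisRep.toLocal v (W.torsionGaloisModule ((p ^ N : ℕ) : ℤ))) 1 := by
          rw [lowerStructure_inr_of_not W p N 𝔭 S T (fun h ↦ hvT h.1)]
          exact acLevelStructure_inr_eq_unramifiedSubgroup W p N 𝔭 S hpv hvS hgood
        have hyv := hy' (Sum.inr v)
        rw [LocalInvariants.dualSelmerStructure_apply, h𝓕,
          (hur (W.torsionGaloisModule ((p ^ N : ℕ) : ℤ)) hMn v (natCast_pow_not_mem p hpv N)
            (isUnramifiedAt_torsionGaloisModule W hgood (intCast_pow_not_mem p hpv N))).1,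
          ← hyW, localization_map_one] at hyv
        have hyWv : galoisCohomology.localization (W.torsionGaloisModule ((p ^ N : ℕ) : ℤ)) (Sum.inr v) 1 yW ∈
            unramifiedSubgroup (GaloisRep.toLocal v (W.torsionGaloisModule ((p ^ N : ℕ) : ℤ))) 1 := by
          have h2 : galoisCohomology.map ((weilDualInv W (p ^ N) ε hμ hadd₁ hadd₂ hgal hnondeg).restrictField
              (Place.Completion (Sum.inr v : Place K))) 1
              (galoisCohomology.map ((weilDualIntertwining W (p ^ N) ε hμ hadd₁ hadd₂ hgal).restrictField
                (Place.Completion (Sum.inr v : Place K))) 1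
                (galoisCohomology.localization (W.torsionGaloisModule ((p ^ N : ℕ) : ℤ)) (Sum.inr v) 1 yW)) ∈
              unramifiedSubgroup (GaloisRep.toLocal v (W.torsionGaloisModule ((p ^ N : ℕ) : ℤ))) 1 :=
            map_mem_unramifiedSubgroup _ hyv
          rwa [map_weilDualInv_map_weilDual_restrictField] at h2
        exact map_primaryInclusion_eq_zero_of_mem_unramifiedSubgroup W p N hpv hgood hyWv
    · exact AddSubgroup.mem_top _

end Transport

end Summit.BirchSwinnertonDyer.Rank1Residual.X11b.AcSelmer

end
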